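import Summits.NavierStokesRegularity.NavierStokesRegularity.Theorems.SymmetricLiouville.Negative.SmallConstantGap
import Literature.Analysis.FluidPDE.TypeIAncientMild

/-!
# Candidate proof (disprover's evidence, NOT a landing) of `stub_smallAtMinusInfinityLiouville`
# — line `blowdown-kills-pitch`, crux `SymmetricLiouville` (stmt-NavierStokesRegularity-4053)

`Sig.stub_smallAtMinusInfinityLiouville` / `stub_smallAtMinusInfinityLiouville` of the lead's
skeleton (`Cruxes/SymmetricLiouville/Lines/blowdown-kills-pitch.lean`, skeleton `415f7ae75d4c`):

  `∀ (C : ℝ) (u : ℝ → E3 → E3), IsTypeIAncientMild C u →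
      (∀ ε > 0, ∃ T < 0, ∀ t < T, ∀ x, √(−t) * ‖u t x‖ ≤ ε) → ∀ t < 0, ∀ x, u t x = 0`

is proved below, sorry-free, from the LANDED gap theorem
`Negative.exists_eps_small_vanishes` (p77402: `sup √(−t)‖u‖ ≤ ε₀ ⇒ u ≡ 0` on `A_C`) and the tree's
past-shift covariance `IsTypeIAncientMild.comp_sub_right` ONLY — no forward-uniqueness theorem is
needed: the gap theorem is applied to the past-shifts `s ↦ u(s + t₁ + η)` in a continuity /
least-bad-time argument (`t₁ = inf` of the bad times; on the short window `[−η, 0)` the crude Type-I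
bound `C/√(−(s+t₁+η))` times `√(−s) ≤ √η` is already `≤ ε₀`). Written by the standing disprover
(refuter-cdisprove-…-4053-g3); the lead may paste it (same namespace as the skeleton).
-/

noncomputable section

open Set Function Filter MeasureTheory
open Literature.Analysis.FluidPDE
open Summit.NavierStokesRegularity.NavierStokesRegularity.Theorems.SymmetricLiouville

namespace Summit.NavierStokesRegularity.NavierStokesRegularity.Theorems.SymmetryModuliCountSymmetricLiouville

/-- Local notation for physical space `ℝ³`. -/
local notation "E3" => EuclideanSpace ℝ (Fin 3)

/-- **One step**: if `u ∈ A_C` vanishes on `(−∞, t₁)` with `t₁ < 0`, then it vanishes on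
`(−∞, t₁ + η)` for `η = ½ ε₀²(−t₁)/(C² + ε₀²)`, where `ε₀` is the gap constant. -/
theorem vanishes_beyond {ε₀ : ℝ} (hε₀ : 0 < ε₀)
    (hgap : ∀ (C : ℝ) (u : ℝ → E3 → E3), Negative.InClass C u →
      (∀ t < 0, ∀ x, Real.sqrt (-t) * ‖u t x‖ ≤ ε₀) → Negative.VanishesOnPast u)
    {C : ℝ} {u : ℝ → E3 → E3} (hcl : IsTypeIAncientMild C u) {t₁ : ℝ} (ht₁ : t₁ < 0)
    (hvan : ∀ t < t₁, ∀ x, u t x = 0) :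
    ∀ t < t₁ + ε₀ ^ 2 * (-t₁) / (C ^ 2 + ε₀ ^ 2) / 2, ∀ x, u t x = 0 := by
  have hC : 0 ≤ C := hcl.nonneg
  set η : ℝ := ε₀ ^ 2 * (-t₁) / (C ^ 2 + ε₀ ^ 2) / 2 with hη
  have hden : 0 < C ^ 2 + ε₀ ^ 2 := by positivity
  have hη0 : 0 < η := by
    rw [hη]
    apply half_pos
    exact div_pos (mul_pos (pow_pos hε₀ 2) (neg_pos.2 ht₁)) hden
  -- `η (C² + ε₀²) ≤ ½ ε₀² (−t₁)`, hence `η < −t₁` and the window inequality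
  have hηle : η * (C ^ 2 + ε₀ ^ 2) = ε₀ ^ 2 * (-t₁) / 2 := by
    rw [hη]
    field_simp
  have hηlt : η < -t₁ := by
    have h1 : η * (C ^ 2 + ε₀ ^ 2) ≤ ε₀ ^ 2 * (-t₁) / 2 := hηle.le
    have h2 : η * ε₀ ^ 2 ≤ η * (C ^ 2 + ε₀ ^ 2) :=
      mul_le_mul_of_nonneg_left (by nlinarith) hη0.le
    have h3 : 0 < ε₀ ^ 2 * (-t₁) := mul_pos (pow_pos hε₀ 2) (neg_pos.2 ht₁)
    nlinarith [pow_pos hε₀ 2]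
  -- the past-shift by `δ = −(t₁ + η) > 0`
  set δ : ℝ := -(t₁ + η) with hδ
  have hδ0 : 0 ≤ δ := by rw [hδ]; linarith
  have hv : IsTypeIAncientMild C (fun s => u (s - δ)) := hcl.comp_sub_right hδ0
  have hvI : Negative.InClass C (fun s => u (s - δ)) := isTypeIAncientMild_iff.1 hv
  -- smallness of the shifted field on the whole past
  have hsmall : ∀ s < 0, ∀ x, Real.sqrt (-s) * ‖u (s - δ) x‖ ≤ ε₀ := by
    intro s hs x
    by_cases hsw : s - δ < t₁
    · rw [hvan _ hsw x, norm_zero, mul_zero]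
      exact hε₀.le
    · -- the window `s − δ ≥ t₁`, i.e. `−s ≤ η`
      push Not at hsw
      have hs' : -s ≤ η := by rw [hδ] at hsw; linarith
      have hpos : 0 < -(s - δ) := by rw [hδ]; linarith
      have hb : ‖u (s - δ) x‖ ≤ C / Real.sqrt (-(s - δ)) := hcl.norm_le (by linarith) x
      have hsq : 0 < Real.sqrt (-(s - δ)) := Real.sqrt_pos.2 hpos
      -- square comparison: `(−s) C² ≤ ε₀² (−(s − δ))`
      have key : (-s) * C ^ 2 ≤ ε₀ ^ 2 * (-(s - δ)) := by
        have h1 : (-s) * C ^ 2 ≤ η * C ^ 2 := mul_le_mul_of_nonneg_right hs' (sq_nonneg C)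
        have h2 : ε₀ ^ 2 * (-t₁ - η) ≤ ε₀ ^ 2 * (-(s - δ)) := by
          apply mul_le_mul_of_nonneg_left _ (sq_nonneg ε₀)
          rw [hδ]; linarith
        have h3 : η * C ^ 2 ≤ ε₀ ^ 2 * (-t₁ - η) := by nlinarith [hηle]
        linarith
      have key' : Real.sqrt (-s) * C ≤ ε₀ * Real.sqrt (-(s - δ)) := by
        have h1 : Real.sqrt ((-s) * C ^ 2) ≤ Real.sqrt (ε₀ ^ 2 * (-(s - δ))) :=
          Real.sqrt_le_sqrt key
        rwa [Real.sqrt_mul (neg_pos.2 hs).le, Real.sqrt_sq hC, Real.sqrt_mul (sq_nonneg ε₀),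
          Real.sqrt_sq hε₀.le] at h1
      calc Real.sqrt (-s) * ‖u (s - δ) x‖ ≤ Real.sqrt (-s) * (C / Real.sqrt (-(s - δ))) :=
            mul_le_mul_of_nonneg_left hb (Real.sqrt_nonneg _)
        _ = Real.sqrt (-s) * C / Real.sqrt (-(s - δ)) := by ring
        _ ≤ ε₀ * Real.sqrt (-(s - δ)) / Real.sqrt (-(s - δ)) :=
            div_le_div_of_nonneg_right key' hsq.le
        _ = ε₀ := by field_simp
  have hzero := hgap C _ hvI hsmall
  intro t ht x
  have ht' : t + δ < 0 := by rw [hδ]; rw [hη] at ht ⊢; linarith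
  have := hzero (t + δ) ht' x
  simpa only [add_sub_cancel_right] using this

/-- **Stub 4 of the skeleton, verbatim signature** (`Sig.stub_smallAtMinusInfinityLiouville`
unfolded): an element of `A_C` with `√(−t)‖u(t)‖_∞ → 0` as `t → −∞` vanishes identically. -/
theorem stub_smallAtMinusInfinityLiouville_proof :
    ∀ (C : ℝ) (u : ℝ → E3 → E3), IsTypeIAncientMild C u →
      (∀ ε > 0, ∃ T < 0, ∀ t < T, ∀ x, Real.sqrt (-t) * ‖u t x‖ ≤ ε) →
      ∀ t < 0, ∀ x, u t x = 0 := by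
  intro C u hcl hsmall
  obtain ⟨ε₀, hε₀, hgap⟩ := Negative.exists_eps_small_vanishes
  obtain ⟨T, hT, hTs⟩ := hsmall ε₀ hε₀
  -- Step 1: `u = 0` on `(−∞, T)` — the gap theorem on the past-shift `s ↦ u(s + T)`
  have hvan0 : ∀ t < T, ∀ x, u t x = 0 := by
    have hv : IsTypeIAncientMild C (fun s => u (s - -T)) := hcl.comp_sub_right (by linarith)
    have hvI : Negative.InClass C (fun s => u (s - -T)) := isTypeIAncientMild_iff.1 hv
    have hsm : ∀ s < 0, ∀ x, Real.sqrt (-s) * ‖u (s - -T) x‖ ≤ ε₀ := by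
      intro s hs x
      have h1 := hTs (s - -T) (by linarith) x
      have h2 : Real.sqrt (-s) ≤ Real.sqrt (-(s - -T)) := Real.sqrt_le_sqrt (by linarith)
      exact (mul_le_mul_of_nonneg_right h2 (norm_nonneg _)).trans h1
    have hz := hgap C _ hvI hsm
    intro t ht x
    have := hz (t + -T) (by linarith) x
    simpa only [add_sub_cancel_right] using this
  -- Step 2: the set of bad times is empty (least bad time + one step of `vanishes_beyond`)
  by_contra hbad
  push Not at hbad
  obtain ⟨t₀, ht₀, x₀, hx₀⟩ := hbad
  set B : Set ℝ := {t | t < 0 ∧ ∃ x, u t x ≠ 0} with hB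
  have hBne : B.Nonempty := ⟨t₀, ht₀, x₀, hx₀⟩
  have hBbdd : BddBelow B := ⟨T, fun b hb => by
    by_contra hlt
    push Not at hlt
    obtain ⟨x, hx⟩ := hb.2
    exact hx (hvan0 b hlt x)⟩
  set t₁ : ℝ := sInf B with ht₁def
  have ht₁le : ∀ b ∈ B, t₁ ≤ b := fun b hb => csInf_le hBbdd hb
  have ht₁neg : t₁ < 0 := (ht₁le t₀ ⟨ht₀, x₀, hx₀⟩).trans_lt ht₀
  have hvan1 : ∀ t < t₁, ∀ x, u t x = 0 := by
    intro t ht x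
    by_contra hx
    have htneg : t < 0 := ht.trans ht₁neg
    exact absurd (ht₁le t ⟨htneg, x, hx⟩) (not_le.2 ht)
  have hstep := vanishes_beyond hε₀ hgap hcl ht₁neg hvan1
  have hηpos : 0 < ε₀ ^ 2 * (-t₁) / (C ^ 2 + ε₀ ^ 2) / 2 := by
    have hC : 0 ≤ C := hcl.nonneg
    apply half_pos
    exact div_pos (mul_pos (pow_pos hε₀ 2) (neg_pos.2 ht₁neg)) (by positivity)
  obtain ⟨b, hb, hblt⟩ := exists_lt_of_csInf_lt hBne
    (show sInf B < t₁ + ε₀ ^ 2 * (-t₁) / (C ^ 2 + ε₀ ^ 2) / 2 by rw [← ht₁def]; linarith)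
  obtain ⟨x, hx⟩ := hb.2
  exact hx (hstep b hblt x)

end Summit.NavierStokesRegularity.NavierStokesRegularity.Theorems.SymmetryModuliCountSymmetricLiouville

end
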